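import Summits.QuantumFields.BalabanUV.Beta.D1BFx.FrozenLegTails

/-!
# `BalabanUV.Beta.D1BFx.GluonLegTails` — road «BF-x» for binder row D1: THE (α)-LEAF `Spr (Ga n a)` OF THE ROAD END IS A THEOREM MODULO
# [B5, Prop. 1.2 (1.110)–(1.114)] AND [B5, (1.126)–(1.127)] BY NAME

HONEST DEPENDENCY (page 1, mandatory): continuum YM on T⁴ ⇐ BetaPertH ∧ nine spine estimates (0/9 proved); BetaPertH ⇐ (D1) ∧ (D4) ∧
CAP+tail; G-an2-4 gates asym, D1 and NE2/3/4.  HONEST FRAMING (cell contract, verbatim): «discharging `BetaPertH` makes Bałaban's UV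
stability UNCONDITIONAL — a real constructive-QFT result; it is NOT the continuum limit and NOT the Clay problem.»  THIS MODULE DISCHARGES
NOTHING of the wall by itself: it turns the displayed hypothesis `hGa : ∀ n ≥ 2, Spr (Ga n a)` of road BF-x's ENDs (`RoadEndBFxRecut.d1Drift_BFx_recut`
p224363 and every twin: «the (α)-leaf `Spr (Ga n a)` (B5 Prop. 1.2 content)») into a consequence of the TWO PRINTED STATEMENTS `B5.Prop12Printed` ∕
`B5.Kernel126_127Printed` taken BY NAME (hypotheses `h12`∕`h126`, exactly an5's; CONDITIONAL result — nothing printed is proved, no `Prop` minted).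
[folklore] otherwise: `FrozenLegTails` §1's method for EVERY component pair (an5's `VectorTailsPt.legs_pt_A` value row + `VectorPropagatorLimit.calG_re_tendsto_Kinf`
+ `Kinf_symm`), the tree's UNCONDITIONAL temperedness `VectorPropagatorLimit.abs_Kinf_le` (B5 (1.89) passed to the limit) for the coincident entry, and
`|w|₁ ≤ 4‖w‖∞`.  0 sorry; 0 wall binders (hW∕hR∕D1Tel∕D1Rep = 0∕4); NOT D1, NOT `BetaPertH`, NOT continuum, NOT Clay.

ABSOLUTE RULE (cell charter, verbatim): «No internally-minted statement may enter as a cited fact. Every hypothesis is either kernel-proved in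
this package or a verbatim quotation of a PUBLISHED theorem with page reference. The manuscript(s) under audit are NOT citable for their own
disputed steps — they are the thing under adjudication; programme-internal (2001/route/tribunal) claims are never citable.»

CONTENT.
* §1 [folklore] `Kinf_entry_le_of_prop12` — every ENTRY of `K^∞` off the coincident site: `|K^∞((b,κ),(b+w,l))| ≤ A₀e^{−(δ/n)‖w‖∞}/‖w‖∞²` (`w ≠ 0`), one
  `δ > 0`, `A₀ ≥ 0` for all scales, sites and components, modulo `h12`∕`h126`.
* §2 [folklore] `l1_le_four_mul_supNorm`, `l1_sub_comm`; **`spr_Ga_of_prop12`** — `Spr (Ga n a)` for every `n ≥ 1`, `a > 0`, modulo `h12`∕`h126`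
  (constant `max A₀ (n²/γ₀(4,a))`, rate `δ/(4n)`), and **`hGa_of_prop12`** — the END's binder `∀ n ≥ 2, ∀ [NeZero n], Spr (Ga n a)` literally.
Unit `b2b-balaban-beta-d1-formalise-leaf-03` (gen 5), D1 formalisation swarm; `LEAVES-BFx.md` sub-row «ALPHA@Prop12».
-/

noncomputable section

namespace Summit.QuantumFields.BalabanUV.Beta.D1BFx.GluonLegTails

open Filter Topology
open Literature.MathematicalPhysics.QuantumFieldTheory.Balaban1983to89
open Literature.MathematicalPhysics.QuantumFieldTheory.Balaban1983to89.Beta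
open B5Prop11Plancherel (calG fine Tor)
open B5Prop11Lattice (gammaZero)
open B12Sec2to5 (l1 l1_nonneg)
open DyadicShell (Pt supNorm)
open ExpKernelCalculus (Decays)
open VectorTails (castT castT_add)
open VectorTailsPt (rd rdM InBox legs_pt_A eventually_inBox abs_re_le)
open VectorTailsLoc (fam kfam)
open VectorPropagatorLimit (Kinf calG_re_tendsto_Kinf Kinf_symm abs_Kinf_le)
open BlockKernelVolumeSockets (evenPeriod)
open FreeLegDictionary (cubic)
open Summit.QuantumFields.BalabanUV.Beta.TameKernelCalculus (Spr)
open Summit.QuantumFields.BalabanUV.Beta.D1BFx.GluonLeg (Ga Ga_apply)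
open Summit.QuantumFields.BalabanUV.Beta.D1BFx.FrozenLegTails (nOf MOf hn1 sides_tendsto)

variable (a : ℝ) (ha : 0 < a)

/-! ## §1 Every entry of `K^∞`, modulo the printed statements -/

/-- [folklore] **THE VALUE TAIL OF EVERY ENTRY OF `K^∞`, MODULO [B5, Prop. 1.2] ∧ [B5, (1.126)–(1.127)] BY NAME**: one rate `δ > 0` and one constant
`A₀ ≥ 0` with `|K^∞((b,κ),(b+w,l))| ≤ A₀e^{−(δ/n)‖w‖∞}/‖w‖∞²` for every `n ≥ 1`, `b`, `w ≠ 0`, `κ`, `l` (an5's value row for the reading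
`n²·Re 𝒢_T((x₀+w,l),(x₀,κ))` on every torus of the family, the entrywise limit, and the symmetry of `K^∞`). -/
theorem Kinf_entry_le_of_prop12 (h12 : B5.Prop12Printed (fam nOf hn1 MOf a ha)) (h126 : B5.Kernel126_127Printed (kfam nOf MOf)) :
    ∃ δ A₀ : ℝ, 0 < δ ∧ 0 ≤ A₀ ∧ ∀ (n : ℕ) [NeZero n] (b w : Pt) (κ l : Fin 4), w ≠ 0 →
      |Kinf n a (b, κ) (b + w, l)| ≤ A₀ * Real.exp (-(δ / n) * supNorm w) / (supNorm w : ℝ) ^ 2 := by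
  obtain ⟨δ, A, hδ, hA, h⟩ := legs_pt_A nOf hn1 MOf a ha h12 h126
  refine ⟨δ, A 0, hδ, hA 0, fun n _ b w κ l hw => ?_⟩
  have hn : 1 ≤ n := Nat.one_le_iff_ne_zero.mpr (NeZero.ne n)
  have hbox : ∀ᶠ t : ℕ in atTop, InBox (fine n (cubic 4 (evenPeriod t))) w :=
    eventually_inBox nOf MOf (l := atTop) (fun t : ℕ => ((⟨n, hn⟩ : ℕ+), t)) (sides_tendsto ⟨n, hn⟩) w
  have key : ∀ t : ℕ, InBox (fine n (cubic 4 (evenPeriod t))) w →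
      |rd n hn (cubic 4 (evenPeriod t)) a ha (castT _ b) l κ Complex.reAddGroupHom w| ≤
        A 0 * Real.exp (-(δ / n) * supNorm w) / (supNorm w : ℝ) ^ 2 := fun t ht =>
    (h ((⟨n, hn⟩ : ℕ+), t) (castT _ b) l κ Complex.reAddGroupHom abs_re_le w hw ht).1
  have erd : ∀ t : ℕ, rd n hn (cubic 4 (evenPeriod t)) a ha (castT _ b) l κ Complex.reAddGroupHom w =
      ((n : ℕ) : ℝ) ^ 2 * (calG n hn (cubic 4 (evenPeriod t)) a ha (castT (fine n (cubic 4 (evenPeriod t))) (b + w), l)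
        (castT (fine n (cubic 4 (evenPeriod t))) b, κ)).re := by
    intro t
    simp only [rd, rdM, VectorLegVolumeAdapter.re_apply, castT_add]
  have lim : Tendsto (fun t => rd n hn (cubic 4 (evenPeriod t)) a ha (castT _ b) l κ Complex.reAddGroupHom w) atTop
      (𝓝 (Kinf n a (b + w, l) (b, κ))) := by
    simp only [erd]
    exact calG_re_tendsto_Kinf n hn a ha (by norm_num) (b + w) b l κ
  rw [← Kinf_symm n hn a ha (by norm_num) (b + w, l) (b, κ)]
  exact le_of_tendsto lim.abs (hbox.mono fun t ht => key t ht)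

/-! ## §2 `Spr (Ga n a)` -/

/-- [folklore] `|w|₁ ≤ 4·‖w‖∞` on `ℤ⁴`. -/
theorem l1_le_four_mul_supNorm (w : Pt) : l1 w ≤ 4 * (supNorm w : ℝ) := by
  unfold B12Sec2to5.l1
  have h : ∀ μ : Fin 4, |((w μ : ℤ) : ℝ)| ≤ (supNorm w : ℝ) := by
    intro μ
    rw [← Int.cast_abs, ← Nat.cast_natAbs]
    exact_mod_cast DyadicShell.natAbs_le_supNorm w μ
  calc ∑ μ : Fin 4, |((w μ : ℤ) : ℝ)| ≤ ∑ _μ : Fin 4, (supNorm w : ℝ) := Finset.sum_le_sum fun μ _ => h μ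
    _ = 4 * (supNorm w : ℝ) := by simp [Finset.sum_const, Finset.card_univ, Fintype.card_fin]

/-- [folklore] `|x − y|₁ = |y − x|₁`. -/
theorem l1_sub_comm {d : ℕ} (x y : Fin d → ℤ) : l1 (x - y) = l1 (y - x) := by
  unfold B12Sec2to5.l1
  refine Finset.sum_congr rfl fun μ _ => ?_
  simp only [Pi.sub_apply, Int.cast_sub]
  exact abs_sub_comm _ _

variable {a}

/-- [folklore] **`Spr (Ga n a)` MODULO [B5, Prop. 1.2] ∧ [B5, (1.126)–(1.127)] BY NAME** — the road END's (α)-leaf binder, every `n ≥ 1`, `a > 0`: the gluon leg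
`Ga n a = K^∞` decays exponentially in `|x − y|₁` at rate `δ/(4n)` with constant `max A₀ (n²/γ₀(4,a))` (the coincident entry by the tree's unconditional
`VectorPropagatorLimit.abs_Kinf_le`). -/
theorem spr_Ga_of_prop12 (h12 : B5.Prop12Printed (fam nOf hn1 MOf a ha)) (h126 : B5.Kernel126_127Printed (kfam nOf MOf)) (n : ℕ) [NeZero n] :
    Spr (Ga n a) := by
  obtain ⟨δ, A₀, hδ, hA₀, h⟩ := Kinf_entry_le_of_prop12 a ha h12 h126
  have hn : 1 ≤ n := Nat.one_le_iff_ne_zero.mpr (NeZero.ne n)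
  have hnpos : (0 : ℝ) < n := by exact_mod_cast (show 0 < n by omega)
  refine ⟨max A₀ (((n : ℕ) : ℝ) ^ 2 * (gammaZero 4 a)⁻¹), δ / (4 * n), by positivity, fun x y κ l => ?_⟩
  rw [Ga_apply]
  by_cases hw : y - x = 0
  · -- the coincident entry: temperedness
    have hyx : y = x := sub_eq_zero.mp hw
    rw [hyx, sub_self]
    have h0 : l1 (0 : Pt) = 0 := by simp [B12Sec2to5.l1]
    rw [h0, mul_zero, Real.exp_zero, mul_one]
    exact (abs_Kinf_le n hn a ha (by norm_num) (x, κ) (x, l)).trans (le_max_right _ _)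
  · -- off the coincident site: the printed tail, `1/‖w‖∞² ≤ 1`, `|w|₁ ≤ 4‖w‖∞`
    have hy : y = x + (y - x) := by abel
    have hK := h n x (y - x) κ l hw
    rw [← hy] at hK
    have hS1 : (1 : ℝ) ≤ (supNorm (y - x) : ℝ) := by
      exact_mod_cast Nat.one_le_iff_ne_zero.mpr (mt DyadicShell.supNorm_eq_zero_iff.mp hw)
    have hE : Real.exp (-(δ / n) * supNorm (y - x)) ≤ Real.exp (-(δ / (4 * n)) * l1 (x - y)) := by
      refine Real.exp_le_exp.mpr ?_
      rw [l1_sub_comm]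
      have h4 := l1_le_four_mul_supNorm (y - x)
      have hδn : 0 ≤ δ / (4 * n) := by positivity
      have : δ / (4 * n) * l1 (y - x) ≤ δ / (4 * n) * (4 * (supNorm (y - x) : ℝ)) := mul_le_mul_of_nonneg_left h4 hδn
      have e : δ / (4 * n) * (4 * (supNorm (y - x) : ℝ)) = δ / n * supNorm (y - x) := by field_simp
      linarith
    calc |Kinf n a (x, κ) (y, l)| ≤ A₀ * Real.exp (-(δ / n) * supNorm (y - x)) / (supNorm (y - x) : ℝ) ^ 2 := hK
      _ ≤ A₀ * Real.exp (-(δ / n) * supNorm (y - x)) := by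
          refine div_le_self (by positivity) ?_
          exact one_le_pow₀ hS1
      _ ≤ max A₀ (((n : ℕ) : ℝ) ^ 2 * (gammaZero 4 a)⁻¹) * Real.exp (-(δ / (4 * n)) * l1 (x - y)) :=
          mul_le_mul (le_max_left _ _) hE (by positivity) (le_trans hA₀ (le_max_left _ _))

/-- [folklore] **THE END's BINDER `hGa`, LITERALLY**: `∀ n ≥ 2, ∀ [NeZero n], Spr (Ga n a)` modulo `h12`∕`h126`. -/
theorem hGa_of_prop12 (h12 : B5.Prop12Printed (fam nOf hn1 MOf a ha)) (h126 : B5.Kernel126_127Printed (kfam nOf MOf)) :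
    ∀ n : ℕ, 2 ≤ n → ∀ [NeZero n], Spr (Ga n a) :=
  fun n _ _ => spr_Ga_of_prop12 ha h12 h126 n

end Summit.QuantumFields.BalabanUV.Beta.D1BFx.GluonLegTails

end
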